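import Summits.QuantumAdvantage.AdviceFreeQNC0.FibreDecimation37Chars
import HarnessLib

/-!
# Cell qa-qnc0, `p = 3` — ROUND-37P2 File B, toolkit: the four elements of `𝔽₄`, values of the trace, linearity of `L_a`

Planner qa-qnc0-p2 g37, ROUND-37P2 §2 (Lemma 37.D / Theorem 37.F′) reads an `𝔽₄`-valued identity through the trace
`Tr : 𝔽₄ → 𝔽₂`.  The kernel toolkit of `WalkCharacters.lean` / `WalkExactLaw.lean` never needed the ENUMERATION of
`𝔽₄ = {0, 1, ω, ω²}`; the decimation identity does (a non-zero coefficient `c` makes `t ↦ Tr(c·ω^t)` a genuine MOD-3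
test).  This file supplies:

* `F4.eq_cases` — every `x : F4` is `0`, `1`, `ω` or `ω²` (from `AdjoinRoot.mk` surjectivity and `deg (f mod X²+X+1) ≤ 1`);
* `F4.tr_cases`, `F4.tr_one`, `F4.tr_tr`, `F4.ne_zero_of_isUnit`, `F4.isUnit_natCast_add_omega` (`n + ω ∈ {ω, ω²}`),
  `F4.exists_pow_of_ne_zero`, `F4.tr_mul_pow_nonconst` (for `c ≠ 0` the map `t ↦ Tr(c ω^{t})` on `ℤ/3` is not constant),
  `F4.eq_of_add_eq_zero`;
* `Lfun_add_fun`, `Lfun_const_mul`, `Lfun_sum_fun`, `Lfun_zero_fun` — `𝔽₄`-linearity of the dual functional `L_a`.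

WHAT THIS IS NOT: no statement about the game; Lemma 37.D and Theorem 37.F′ are in the sequel files.
-/

noncomputable section

namespace Summit.QuantumAdvantage.AdviceFreeQNC0

open Finset Polynomial
open F4

namespace F4

/-- The defining polynomial `X² + X + 1 ∈ 𝔽₂[X]` is monic. -/
theorem defPoly_monic : (X ^ 2 + X + 1 : (ZMod 2)[X]).Monic := by
  monicity!

/-- The defining polynomial has degree `2`. -/
theorem defPoly_natDegree : (X ^ 2 + X + 1 : (ZMod 2)[X]).natDegree = 2 := by
  compute_degree!

/-- Values in `𝔽₂`. -/
private theorem zmod2_cases (c : ZMod 2) : c = 0 ∨ c = 1 := by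
  revert c; decide

/-- **`𝔽₄ = {0, 1, ω, ω²}`.** -/
theorem eq_cases (x : F4) : x = 0 ∨ x = 1 ∨ x = ω ∨ x = ω ^ 2 := by
  induction x using AdjoinRoot.induction_on with
  | ih f =>
    set g : (ZMod 2)[X] := X ^ 2 + X + 1 with hg
    have hmonic : g.Monic := defPoly_monic
    have hmk : AdjoinRoot.mk g f = AdjoinRoot.mk g (f %ₘ g) :=
      (AdjoinRoot.mk_leftInverse hmonic (AdjoinRoot.mk g f)).symm
    have hdeg : (f %ₘ g).natDegree ≤ 1 := by
      have hne : g ≠ 1 := by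
        intro h1
        have h2 := defPoly_natDegree
        rw [← hg, h1, natDegree_one] at h2
        exact absurd h2 (by norm_num)
      have h := Polynomial.natDegree_modByMonic_lt f hmonic hne
      rw [defPoly_natDegree] at h
      omega
    have hform := Polynomial.eq_X_add_C_of_natDegree_le_one hdeg
    set c₁ := (f %ₘ g).coeff 1
    set c₀ := (f %ₘ g).coeff 0
    have hx : AdjoinRoot.mk g f = AdjoinRoot.of g c₁ * ω + AdjoinRoot.of g c₀ := by
      rw [hmk, hform, map_add, map_mul, AdjoinRoot.mk_C, AdjoinRoot.mk_C, AdjoinRoot.mk_X]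
      rfl
    rcases zmod2_cases c₁ with h1 | h1 <;> rcases zmod2_cases c₀ with h0 | h0 <;>
      rw [h1, h0] at hx <;> simp only [map_zero, map_one, zero_mul, one_mul, zero_add, add_zero] at hx
    · exact Or.inl hx
    · exact Or.inr (Or.inl hx)
    · exact Or.inr (Or.inr (Or.inl hx))
    · right; right; right
      rw [hx, omega_sq, add_comm]

/-- `1 ≠ 0` in `𝔽₄`. -/
theorem one_ne_zero' : (1 : F4) ≠ 0 := by
  haveI := F4.nontrivial
  exact one_ne_zero

/-- Units of `𝔽₄` are non-zero (the ring is nontrivial). -/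
theorem ne_zero_of_isUnit {x : F4} (h : IsUnit x) : x ≠ 0 := by
  haveI := F4.nontrivial
  exact h.ne_zero

/-- `n + ω` is a unit for every natural number `n` (it is `ω` or `1 + ω = ω²` according to the parity of `n`). -/
theorem isUnit_natCast_add_omega (n : ℕ) : IsUnit ((n : F4) + ω) := by
  rw [natCast_eq]
  split_ifs
  · rw [one_add_omega]; exact isUnit_omega_pow 2
  · rw [zero_add, ← pow_one ω]; exact isUnit_omega_pow 1

/-- `n + ω` as a power of `ω`: `ω²` if `n` is odd, `ω` if `n` is even. -/
theorem natCast_add_omega_eq (n : ℕ) : (n : F4) + ω = if n % 2 = 1 then ω ^ 2 else ω ^ 1 := by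
  rw [natCast_eq]
  split_ifs
  · exact one_add_omega
  · rw [zero_add, pow_one]

/-- `tr 1 = 0`. -/
theorem tr_one : tr 1 = 0 := by
  unfold tr; rw [one_pow, add_self]

/-- `tr ω = 1`. -/
theorem tr_omega : tr ω = 1 := by
  have h := tr_omega_pow 1
  rwa [pow_one] at h

/-- `tr ω² = 1`. -/
theorem tr_omega_sq : tr (ω ^ 2) = 1 := tr_omega_pow 2

/-- **The trace takes values in `𝔽₂ = {0, 1}`.** -/
theorem tr_cases (x : F4) : tr x = 0 ∨ tr x = 1 := by
  rcases eq_cases x with rfl | rfl | rfl | rfl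
  · exact Or.inl tr_zero
  · exact Or.inl tr_one
  · exact Or.inr tr_omega
  · exact Or.inr tr_omega_sq

/-- `tr (tr x) = 0` (`Tr` vanishes on `𝔽₂`). -/
theorem tr_tr (x : F4) : tr (tr x) = 0 := by
  rcases tr_cases x with h | h
  · rw [h, tr_zero]
  · rw [h, tr_one]

/-- A non-zero element of `𝔽₄` is a power of `ω`. -/
theorem exists_pow_of_ne_zero {x : F4} (hx : x ≠ 0) : ∃ j : ℕ, j < 3 ∧ x = ω ^ j := by
  rcases eq_cases x with rfl | rfl | rfl | rfl
  · exact absurd rfl hx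
  · exact ⟨0, by norm_num, (pow_zero ω).symm⟩
  · exact ⟨1, by norm_num, (pow_one ω).symm⟩
  · exact ⟨2, by norm_num, rfl⟩

/-- **A non-zero coefficient gives a genuine MOD-3 test**: for `c ≠ 0`, `t ↦ tr(c·ω^{t})` is not constant on `ℤ/3`. -/
theorem tr_mul_pow_nonconst {c : F4} (hc : c ≠ 0) :
    ∃ t t' : ZMod 3, tr (c * ω ^ t.val) ≠ tr (c * ω ^ t'.val) := by
  obtain ⟨j, hj, rfl⟩ := exists_pow_of_ne_zero hc
  -- `t = -j` gives `tr 1 = 0`, `t = 1 - j` gives `tr ω = 1`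
  refine ⟨-(j : ZMod 3), 1 - (j : ZMod 3), ?_⟩
  rw [← pow_add, ← pow_add, tr_omega_pow, tr_omega_pow]
  have hv1 : (j + (-(j : ZMod 3)).val) % 3 = 0 := by
    interval_cases j <;> decide
  have hv2 : (j + (1 - (j : ZMod 3)).val) % 3 = 1 := by
    interval_cases j <;> decide
  rw [hv1, hv2]
  simp only [if_true, Nat.one_ne_zero, if_false]
  exact fun h => one_ne_zero' h.symm

/-- In characteristic `2`, `x + y = 0` means `x = y`. -/
theorem eq_of_add_eq_zero {x y : F4} (h : x + y = 0) : x = y := by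
  linear_combination h - y * two_eq_zero

/-- `x + x = 0`, additive-inverse form: `x = y ↔ x + y = 0`. -/
theorem add_eq_zero_iff_eq' (x y : F4) : x + y = 0 ↔ x = y :=
  ⟨eq_of_add_eq_zero, fun h => by rw [h, add_self]⟩

end F4

/-! ### Linearity of the dual functional `L_a` -/

variable {m : ℕ}

/-- `L_a` is additive (pointwise form). -/
theorem Lfun_add_fun (a : Fin m → Bool) (f g : (Fin m → Bool) → F4) :
    Lfun a (fun w => f w + g w) = Lfun a f + Lfun a g := by
  unfold Lfun
  rw [← Finset.sum_add_distrib]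
  exact Finset.sum_congr rfl fun u _ => by rw [add_mul]

/-- `L_a` commutes with constant factors. -/
theorem Lfun_const_mul (a : Fin m → Bool) (c : F4) (f : (Fin m → Bool) → F4) :
    Lfun a (fun w => c * f w) = c * Lfun a f := by
  unfold Lfun
  rw [Finset.mul_sum]
  exact Finset.sum_congr rfl fun u _ => by rw [mul_assoc]

/-- `L_a` commutes with constant factors on the right. -/
theorem Lfun_mul_const (a : Fin m → Bool) (c : F4) (f : (Fin m → Bool) → F4) :
    Lfun a (fun w => f w * c) = c * Lfun a f := by
  rw [← Lfun_const_mul]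
  exact congrArg (Lfun a) (funext fun w => mul_comm _ _)

/-- `L_a` of the zero function. -/
theorem Lfun_zero_fun (a : Fin m → Bool) : Lfun a (fun _ => (0 : F4)) = 0 := by
  unfold Lfun; simp

/-- `L_a` commutes with finite sums (pointwise form). -/
theorem Lfun_sum_fun {κ : Type*} (a : Fin m → Bool) (s : Finset κ) (f : κ → (Fin m → Bool) → F4) :
    Lfun a (fun w => ∑ k ∈ s, f k w) = ∑ k ∈ s, Lfun a (f k) := by
  classical
  induction s using Finset.induction_on with
  | empty => simp only [Finset.sum_empty]; exact Lfun_zero_fun a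
  | insert j s hj ih =>
    simp only [Finset.sum_insert hj]
    rw [← ih, ← Lfun_add_fun]

/-- `L_a` of a constant function: `L_a(c) = c · L_a(1)`. -/
theorem Lfun_const (a : Fin m → Bool) (c : F4) : Lfun a (fun _ => c) = c * Lfun a (fun _ => 1) := by
  rw [← Lfun_const_mul]; simp only [mul_one]

end Summit.QuantumAdvantage.AdviceFreeQNC0

end
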